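import Summits.FinalStateConjecture.FinalStateConjecture.Theses.PhaseMixingCapture
import Literature.Geometry.Lorentzian.Sweep2

/-!
# `NearExtremalKappaCapture` (crux stmt-FinalStateConjecture-10606, route PhaseMixingCapture),
# line `polynomial-closure`: what the gr.S27 admissible class does NOT contain
# (negative-side support, drefute seat)

The linear hypothesis of the line's transfer stub (`stub_polynomialClosing`) and its linear stub
`C⁺` (`stub_kappaPolynomialTeukolskyLaw`) quantify over `Kerr.IsAdmissibleTeukolskyField M a s α`
(Sweep2.lean): spin-weighted fields on the OPEN exterior `{r > r₊}` whose smooth tensor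
representative has Cauchy data compactly supported in the OPEN leaf `{t* = 0, r > r₊}`. Two
kernel-checked facts used by the drefute notes (`Cruxes/NearExtremalKappaCapture/DrefuteNote*.md`):

* `collar_of_admissibleTeukolskyField` — every admissible field has a smooth representative `T`
  with `T = 0` and `dT = 0` on a COLLAR `{t* = 0, r₊ < r < r₊ + ε}` of the horizon sphere,
  `ε = ε(α) > 0`. Hence the class never contains data with non-zero trace on `H⁺ ∩ {t* = 0}`,
  whereas the crux perturbs data on `Kerr.slice a M = {t* = 0, r > M}`, `M < r₊`: the estimate
  `TeukolskyLawAt` constrains the solution operator only on the closure of such data (a closed,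
  proper subspace of the finite-energy data), so no bound with any finite constant transfers to
  horizon-crossing fields — the near-horizon linear theory is NOT discharged by the hypothesis.
* `radius_le_spatialNorm` (`r_a(x) ≤ ‖x⃗‖`, i.e. `ρ² = r² + a² sin²θ ≥ r²`) and
  `teukolskyEnergy_closedBall_eq_zero` — for `R ≤ max r₊ 0` the local region
  `{‖y‖ ≤ R} ∩ {r > r₊}` is empty and every local Teukolsky energy vanishes: the law
  `TeukolskyLawAt M a k w R Λ` is trivially true there (a degenerate instance of the `∃ R` of the
  transfer stub, useless as a hypothesis).

Nothing here closes or refutes the crux.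
-/

noncomputable section

set_option linter.dupNamespace false

namespace Summit.FinalStateConjecture.FinalStateConjecture.Theorems.NearExtremalKappaCapture.Negative

open Literature.Geometry.Lorentzian
open scoped Manifold ContDiff Topology ENNReal
open Set Filter MeasureTheory

/-- **Admissible Teukolsky fields carry zero Cauchy data on a horizon collar.** For
`Kerr.IsAdmissibleTeukolskyField M a s α` there are a representative `T` (agreeing with the
tensorisation off the axis) and `ε > 0` such that `T x = 0` and `dT x = 0` at every point of the
initial leaf with `r_a(x) < r₊ + ε`: the compact support `K ⊆ {r > r₊}` of the data stays a positive
`r`-distance away from the horizon sphere (minimum of the continuous `r` on `K`). -/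
theorem collar_of_admissibleTeukolskyField [Kerr.Facts] {M a : ℝ}
    [(Kerr.metric M a (Kerr.rPlus M a)).HasLeviCivita] {s : ℤ} {α : Kerr.exterior M a → ℂ}
    (h : Kerr.IsAdmissibleTeukolskyField M a s α) :
    ∃ T : Kerr.exterior M a → Fin 4 → Fin 4 → ℂ,
      ContMDiff 𝓘(ℝ, E4) 𝓘(ℝ, Fin 4 → Fin 4 → ℂ) ∞ T ∧
      (∀ x : Kerr.exterior M a, x.1 ∉ Kerr.axis → T x = Kerr.tensorise a s α x) ∧
      ∃ ε : ℝ, 0 < ε ∧ ∀ x : Kerr.exterior M a, (x : E4) 0 = 0 →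
        Kerr.radius a x < Kerr.rPlus M a + ε →
          T x = 0 ∧ mfderiv 𝓘(ℝ, E4) 𝓘(ℝ, Fin 4 → Fin 4 → ℂ) T x = 0 := by
  obtain ⟨⟨T, hTs, hT, K, hK, hdata⟩, -⟩ := h
  refine ⟨T, hTs, hT, ?_⟩
  by_cases hne : K.Nonempty
  · have hcont : ContinuousOn (fun x : Kerr.exterior M a ↦ Kerr.radius a x.1) K :=
      ((Kerr.continuous_radius a).comp continuous_subtype_val).continuousOn
    obtain ⟨x₀, hx₀K, hmin⟩ := hK.exists_isMinOn hne hcont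
    have hx₀ : Kerr.rPlus M a < Kerr.radius a x₀.1 :=
      (le_max_left _ _).trans_lt (Kerr.mem_exterior.1 x₀.2)
    refine ⟨Kerr.radius a x₀.1 - Kerr.rPlus M a, sub_pos.2 hx₀, fun x hx0 hxr ↦ hdata x hx0 ?_⟩
    intro hxK
    have hle := hmin hxK
    simp only [mem_setOf_eq] at hle
    linarith
  · exact ⟨1, one_pos, fun x hx0 _ ↦ hdata x hx0 fun hxK ↦ hne ⟨x, hxK⟩⟩

/-- **`r_a(x) ≤ ‖x⃗‖`**: the Kerr–Schild radius never exceeds the Euclidean spatial radius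
(`ρ² = r² + a² sin²θ`; from the defining quartic `r⁴ − (ρ² − a²) r² − a² z² = 0` and `z² ≤ ρ²`). -/
theorem radius_le_spatialNorm (a : ℝ) (x : E4) : Kerr.radius a x ≤ E4.spatialNorm x := by
  have hq := Kerr.radius_quartic a x
  have hr := Kerr.radius_nonneg a x
  have hρ := E4.spatialNorm_nonneg x
  by_contra hlt
  push Not at hlt
  have h1 : E4.spatialNorm x ^ 2 < Kerr.radius a x ^ 2 := by nlinarith
  have hz : x 3 ^ 2 ≤ E4.spatialNorm x ^ 2 := by
    have h3 : x 3 = E4.spatial x 2 := rfl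
    have hn : E4.spatialNorm x ^ 2 = ∑ i, ‖E4.spatial x i‖ ^ 2 := by
      rw [E4.spatialNorm, EuclideanSpace.norm_eq,
        Real.sq_sqrt (Finset.sum_nonneg fun i _ ↦ by positivity)]
    rw [hn, Fin.sum_univ_three, h3]
    have e : ‖E4.spatial x 2‖ ^ 2 = (E4.spatial x 2) ^ 2 := by rw [Real.norm_eq_abs, sq_abs]
    nlinarith [sq_nonneg ‖E4.spatial x 0‖, sq_nonneg ‖E4.spatial x 1‖]
  have hA : 0 < Kerr.radius a x ^ 2 * (Kerr.radius a x ^ 2 - E4.spatialNorm x ^ 2) :=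
    mul_pos (by nlinarith) (by nlinarith)
  have hB : 0 ≤ a ^ 2 * (Kerr.radius a x ^ 2 - x 3 ^ 2) := mul_nonneg (sq_nonneg a) (by nlinarith)
  have key : Kerr.radius a x ^ 2 * (Kerr.radius a x ^ 2 - E4.spatialNorm x ^ 2) +
      a ^ 2 * (Kerr.radius a x ^ 2 - x 3 ^ 2) = 0 := by
    linear_combination hq
  linarith

/-- **Below the horizon scale every local Teukolsky energy vanishes.** If `R ≤ max r₊ 0` then no
point `(τ, y)` with `‖y‖ ≤ R` lies in the exterior `{max r₊ 0 < r}` (`r ≤ ‖y‖`), so the integrand of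
`Kerr.teukolskyEnergy … (Metric.closedBall 0 R)` vanishes identically: the law `TeukolskyLawAt`
at such `R` is true for every constant and carries no information. -/
theorem teukolskyEnergy_closedBall_eq_zero {M a R : ℝ} (hR : R ≤ max (Kerr.rPlus M a) 0) (s : ℤ)
    (α : Kerr.exterior M a → ℂ) (τ : ℝ) (k : ℕ) (p : ℝ) :
    Kerr.teukolskyEnergy M a s α τ k p (Metric.closedBall 0 R) = 0 := by
  unfold Kerr.teukolskyEnergy sliceSobolevEnergy
  refine le_antisymm ?_ bot_le
  calc _ ≤ ∫⁻ _ in Metric.closedBall (0 : E3) R, (0 : ℝ≥0∞) := by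
        refine setLIntegral_mono' measurableSet_closedBall fun y hy ↦ ?_
        have hnot : y ∉ {y : E3 | E4.ofTimeSpace τ y ∈ Kerr.exterior M a} := by
          intro hmem
          have h1 : max (Kerr.rPlus M a) 0 < Kerr.radius a (E4.ofTimeSpace τ y) :=
            Kerr.mem_exterior.1 hmem
          have h2 := radius_le_spatialNorm a (E4.ofTimeSpace τ y)
          rw [E4.spatialNorm_ofTimeSpace] at h2
          have h3 : ‖y‖ ≤ R := mem_closedBall_zero_iff.1 hy
          linarith
        rw [Set.indicator_of_notMem hnot]
    _ = 0 := by simp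

end Summit.FinalStateConjecture.FinalStateConjecture.Theorems.NearExtremalKappaCapture.Negative

end
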